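import Literature.NumberTheory.EllipticCurves.PAdicBSDGreenbergStevensProofs
import Literature.NumberTheory.EllipticCurves.PAdicLFunctionMinusIntegralityProofs
import Literature.NumberTheory.EllipticCurves.PAdicLFunctionIntegralityAtTwoProofs
import Literature.NumberTheory.EllipticCurves.CuspFormLFunctionLevelConductorProofs
import Literature.NumberTheory.EllipticCurves.PAdicBSDProofs
import HarnessLib

/-!
# `L₂(E, T) ∈ ℤ₂⟦T⟧` at a SPLIT MULTIPLICATIVE `2` — unconditionally (INT2-AUTO-sp)

Topic `NumberTheory/EllipticCurves`; proofs-companion of `PAdicLFunctionIntegralityAtTwoAutoProofs.lean`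
(INT2-AUTO: `L₂(f, α) ∈ Λ` for every curve GOOD ordinary at `2`) for the `2`-adic `L`-function at a
prime of SPLIT MULTIPLICATIVE reduction, i.e. THE power series `L` of the package
`IsSplitMultPAdicLFunctionOf f 2 L` (Mazur–Tate–Teitelbaum 1986, §I.10 with `ε(2) = 0`, `α = a₂ = 1`;
unique, `existsUnique_isSplitMultPAdicLFunctionOf_holds`). Theorems only; no named fact.

O1 class-closure (X5, `p = 2`, non-CM), typer cc-typer-4 gen 4: this discharges the Néron-integrality
certificate `hint` of the split-`2` consumers of `Summits/…/X5/TwoAdicTargetsSplitEndAlpha.lean` (lens-3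
route L3-13, S5) to ONE inequality `0 ≤ ord₂ ϖ` on the period ratio, as INT2-AUTO did for the α-go
line; the o1 refuter (REFUTER-O1 v7 §30, 2026-08-21) predicted it: "INT2-AUTO-sp is AUTOMATIC
(`[1/2]⁺ = (a₂ − 1)[0]⁺ = 0`)".

## The argument (all inputs are tree theorems)

For the newform `f ∈ S₂(Γ₀(N))` of a curve split multiplicative at `2` one has `2 ∣ N`, `4 ∤ N`
(`IsNewformOf.dvd_level_of_split`, `….not_sq_dvd_level_of_lFunction_ne_zero`: `a₂ = 1 ≠ 0`), `a₂(f) = 1`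
(`IsNewformOf.cuspCoeff_eq_one_and_sq_of_split`) and rational, real symbols. Then:
* `[1/2]⁺_f = 0` — the `U₂`-distribution relation `∑_{b mod 2} [b/2]⁺ = a₂⁻¹·[0]⁺ = [0]⁺`
  (`sum_fiber_ratPlusSymbol_eq` at level `0`; MTT §I.4 (4.2) with `ε(2) = 0`);
* `[a/2ᵐ]⁺_f − [1/2]⁺_f ∈ ½ℤ` for `m ≥ 1` — every cusp `a/2ᵐ` is `Γ₀(2M)`-equivalent to `1/2`
  (`modularSymbol_div_sub_half_mem_periodLattice`, Cremona Lemma 2.2.3) and `re Λ_f = ℤ·Ω⁺_f/2`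
  (`realPeriods_eq_zmultiples_of_plusPeriod_ne_zero`); hence `[a/2ᵐ]⁺ ∈ ½ℤ`, `‖[a/2ᵐ]⁺‖₂ ≤ 2`;
* the coefficients of `L` are limits of the Riemann sums `∑_{u=±1} ∑_{s mod 2ⁿ} [u5ˢ/2ⁿ⁺²]⁺·C(s,k)`
  (`IsSplitMultPAdicLFunctionOf.tendsto_riemannSum_coeff`, MTT §I.13), and the `Δ = {±1}` DOUBLING
  (`[(−x)/2ʲ]⁺ = [x/2ʲ]⁺`: periodicity + evenness) makes each Riemann sum `2 ×` a sum of terms of norm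
  `≤ 2`, so of norm `≤ 1`; the unit ball is closed.
So `‖[Tᵏ]L‖₂ ≤ 1` for all `k` (`norm_coeff_le_one_of_isSplitMultPAdicLFunctionOf_two`) and `L = ι L₀`
for a unique `L₀ ∈ Λ` (`exists_iwasawaToPowerSeries_eq_of_isSplitMultPAdicLFunctionOf_two`).

## References

* B. Mazur, J. Tate, J. Teitelbaum, *On `p`-adic analogues of the conjectures of Birch and
  Swinnerton-Dyer*, Invent. Math. 84 (1986), §I.4 (4.2), §I.8, §I.10, §I.12–I.13.
  [MazurTateTeitelbaum1986Invent]
* J. E. Cremona, *Algorithms for modular elliptic curves* (2nd ed., 1997), §2.2 Lemma 2.2.3, §2.8.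
  [CremonaAlgorithms1997]
* Ju. I. Manin, *Parabolic points and zeta functions of modular curves* (1972), Prop. 1.4, Thm. 1.6.
  [Manin1972]
-/

set_option autoImplicit false

noncomputable section

open scoped MatrixGroups ModularForm

open CongruenceSubgroup WeierstrassCurve Filter Topology
  Literature.NumberTheory.EllipticCurves.ModularForms

namespace Literature.NumberTheory.EllipticCurves

section Symbols

variable {N : ℕ} [NeZero N] (f : CuspForm (Gamma0 N) 2)

/-- **`[r]⁺_f − [r₀]⁺_f ∈ ½ℤ` when `{∞, r} ≡ {∞, r₀} (mod Λ_f)`** (rational real-coefficient symbols,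
`hrat`/`hreal`): `re{∞,r} = re{∞,r₀} + k·Ω⁺_f/2` since `re Λ_f = ℤ·Ω⁺_f/2`
(`realPeriods_eq_zmultiples_of_plusPeriod_ne_zero`, `exists_re_eq_add_of_sub_mem`); junk case
`Ω⁺_f = 0`: both symbols vanish. The plus twin of `exists_ratMinusSymbol_eq_div_two_of_sub_mem`.
[cite: CremonaAlgorithms1997, §2.8] [cite: MazurTateTeitelbaum1986Invent, §I.8] -/
theorem exists_ratPlusSymbol_sub_eq_div_two_of_sub_mem
    (hrat : ∀ r : ℚ, (ratPlusSymbol f r : ℝ) = normalizedPlusSymbol f r)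
    (hreal : ∀ n, (cuspCoeff f n).im = 0) {r r₀ : ℚ}
    (h : modularSymbol f r - modularSymbol f r₀ ∈ periodLattice f) :
    ∃ k : ℤ, ratPlusSymbol f r - ratPlusSymbol f r₀ = (k : ℚ) / 2 := by
  by_cases hΩ : plusPeriod f = 0
  · refine ⟨0, ?_⟩
    have h1 : (ratPlusSymbol f r : ℝ) = 0 := by
      rw [hrat, normalizedPlusSymbol_eq_zero_of_plusPeriod_eq_zero f hΩ]
    have h2 : (ratPlusSymbol f r₀ : ℝ) = 0 := by
      rw [hrat, normalizedPlusSymbol_eq_zero_of_plusPeriod_eq_zero f hΩ]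
    have h1' : ratPlusSymbol f r = 0 := by exact_mod_cast h1
    have h2' : ratPlusSymbol f r₀ = 0 := by exact_mod_cast h2
    rw [h1', h2']
    simp
  obtain ⟨hre, hpos⟩ := realPeriods_eq_zmultiples_of_plusPeriod_ne_zero f hΩ
  obtain ⟨k, hk⟩ := exists_re_eq_add_of_sub_mem f hre h
  refine ⟨k, ?_⟩
  apply Rat.cast_injective (α := ℝ)
  push_cast
  rw [hrat, hrat, normalizedPlusSymbol, normalizedPlusSymbol, plusSymbol_eq_re_holds f hreal r,
    plusSymbol_eq_re_holds f hreal r₀, Complex.ofReal_re, Complex.ofReal_re, hk]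
  field_simp
  ring

/-- **`[r]⁺_f − [1/2]⁺_f ∈ ½ℤ` at every cusp of `2`-power denominator `≥ 2`, for `2 ∣ N`, `4 ∤ N`**
(`N = 2M`, `M` odd): `{∞, r} ≡ {∞, 1/2} (mod Λ_f)` (`modularSymbol_div_sub_half_mem_periodLattice`,
Cremona Lemma 2.2.3: all cusps `a/2ᵐ`, `m ≥ 1`, are `Γ₀(2M)`-equivalent to `1/2`). The plus twin of the
`2 ∣ N` branch of `exists_ratMinusSymbol_eq_div_two`. [cite: CremonaAlgorithms1997, §2.2 Lemma 2.2.3]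
[cite: MazurTateTeitelbaum1986Invent, §I.8] -/
theorem exists_ratPlusSymbol_sub_half_eq_div_two
    (hrat : ∀ r : ℚ, (ratPlusSymbol f r : ℝ) = normalizedPlusSymbol f r)
    (hreal : ∀ n, (cuspCoeff f n).im = 0) (h2N : 2 ∣ N) (h4 : ¬ 4 ∣ N)
    {r : ℚ} {n : ℕ} (hr : r.den ∣ 2 ^ n) (hr1 : r.den ≠ 1) :
    ∃ k : ℤ, ratPlusSymbol f r - ratPlusSymbol f (1 / 2) = (k : ℚ) / 2 := by
  obtain ⟨m, -, hm⟩ := (Nat.dvd_prime_pow Nat.prime_two).mp hr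
  have hm0 : m ≠ 0 := by
    rintro rfl
    rw [pow_zero] at hm
    exact hr1 hm
  obtain ⟨m', rfl⟩ : ∃ m', m = m' + 1 := ⟨m - 1, by omega⟩
  obtain ⟨M, hM⟩ := h2N
  have hModd : ¬ 2 ∣ M := fun ⟨t, ht⟩ ↦ h4 ⟨t, by rw [hM, ht]; ring⟩
  have hN : (N : ℤ) = 2 * (M : ℤ) := by exact_mod_cast hM
  have hden : ((r.den : ℕ) : ℤ) = 2 * (2 : ℤ) ^ m' := by rw [hm]; push_cast; ring
  have hden0 : ((r.den : ℕ) : ℤ) ≠ 0 := by exact_mod_cast r.den_ne_zero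
  have hac : IsCoprime r.num ((r.den : ℕ) : ℤ) := by
    rw [Int.isCoprime_iff_gcd_eq_one, Int.gcd, Int.natAbs_natCast]
    exact r.reduced
  have h2M : IsCoprime (2 : ℤ) (M : ℤ) :=
    Nat.isCoprime_iff_coprime.mpr ((Nat.Prime.coprime_iff_not_dvd Nat.prime_two).mpr hModd)
  have hcM : IsCoprime ((r.den : ℕ) : ℤ) (M : ℤ) := by
    rw [hden, ← pow_succ']
    exact h2M.pow_left
  have h := modularSymbol_div_sub_half_mem_periodLattice f hN hden hden0 hac hcM
  have hr' : ((r.num : ℤ) : ℚ) / (((r.den : ℕ) : ℤ) : ℚ) = r := by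
    push_cast
    exact Rat.num_div_den r
  rw [hr'] at h
  exact exists_ratPlusSymbol_sub_eq_div_two_of_sub_mem f hrat hreal h

/-- **`[1/2]⁺_f = 0` when `2 ∣ N` and `a₂(f) = 1`** (the split multiplicative case): the
`U₂`-distribution relation of the measure `[a/2ⁿ]⁺` (`sum_fiber_ratPlusSymbol_eq`, MTT §I.4 (4.2) with
`ε(2) = 0`, `α = a₂ = 1`) at level `0` reads `[0/2]⁺ + [1/2]⁺ = [0]⁺`. (o1 refuter v7 §30:
"`[1/2]⁺ = (a₂ − 1)[0]⁺ = 0`".) [cite: MazurTateTeitelbaum1986Invent, §I.4 (4.2) and §I.10 (ε(p) = 0)] -/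
theorem ratPlusSymbol_half_eq_zero_of_cuspCoeff_two_eq_one
    (hrat : ∀ r : ℚ, (ratPlusSymbol f r : ℝ) = normalizedPlusSymbol f r)
    (hf : IsNewform0 f) (h2N : 2 ∣ N) (ha₂ : cuspCoeff f 2 = 1) :
    ratPlusSymbol f (1 / 2) = 0 := by
  haveI : Fact (Nat.Prime 2) := ⟨Nat.prime_two⟩
  haveI : Subsingleton (ZMod (2 ^ 0)) := by
    show Subsingleton (ZMod 1)
    infer_instance
  have h := sum_fiber_ratPlusSymbol_eq (p := 2) hrat hf h2N ha₂ 0 0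
  rw [Finset.filter_true_of_mem (fun b _ => Subsingleton.elim _ _)] at h
  have hsum : ∑ b : ZMod (2 ^ (0 + 1)),
      (ratPlusSymbol f ((b.val : ℚ) / ((2 : ℕ) : ℚ) ^ (0 + 1)) : ℚ_[2]) =
      (ratPlusSymbol f 0 : ℚ_[2]) + (ratPlusSymbol f (1 / 2) : ℚ_[2]) := by
    have h2 : ∀ g : ZMod (2 ^ (0 + 1)) → ℚ_[2], ∑ b, g b = g 0 + g 1 := fun g ↦
      Fin.sum_univ_two (f := fun b : Fin 2 => g b)
    rw [h2]
    congr 2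
    simp
  rw [hsum] at h
  have h0 : (ratPlusSymbol f (((0 : ZMod (2 ^ 0)).val : ℚ) / ((2 : ℕ) : ℚ) ^ 0) : ℚ_[2]) =
      (ratPlusSymbol f 0 : ℚ_[2]) := by simp
  rw [h0, add_eq_left] at h
  exact_mod_cast h

end Symbols

section Split

variable {W : WeierstrassCurve ℚ} {N : ℕ} [NeZero N] {f : CuspForm (Gamma0 N) 2}

/-- The `2`-adic roots of unity of order dividing `2` are `±1` (private helper, as in
`PAdicLFunctionIntegralityAtTwoProofs`). [folklore] -/
private theorem coe_rootsOfUnity_two_eq_or' (ξ : rootsOfUnity 2 ℤ_[2]) :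
    ((ξ : ℤ_[2]ˣ) : ℤ_[2]) = 1 ∨ ((ξ : ℤ_[2]ˣ) : ℤ_[2]) = -1 := by
  have h := ξ.2
  rw [mem_rootsOfUnity] at h
  have h' : (((ξ : ℤ_[2]ˣ) : ℤ_[2])) ^ 2 = 1 := by
    rw [← Units.val_pow_eq_pow_val, h, Units.val_one]
  exact sq_eq_one_iff.mp h'

/-- `Σᶠ_{ξ ∈ μ₂(ℤ₂)} g(ξ) = g(1) + g(−1)`: the torsion of `ℤ₂^×` is `{±1}` (private helper; the
enumeration step of `padicLRiemannSum_two`). [folklore] -/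
private theorem finsum_rootsOfUnity_two_eq {M : Type*} [AddCommMonoid M] (g : ℤ_[2] → M) :
    ∑ᶠ ξ : rootsOfUnity 2 ℤ_[2], g ((ξ : ℤ_[2]ˣ) : ℤ_[2]) = g 1 + g (-1) := by
  classical
  have hζmem : (-1 : ℤ_[2]ˣ) ∈ rootsOfUnity 2 ℤ_[2] := by
    rw [mem_rootsOfUnity]; norm_num
  set ζ : rootsOfUnity 2 ℤ_[2] := ⟨-1, hζmem⟩ with hζ
  have hne : (1 : rootsOfUnity 2 ℤ_[2]) ≠ ζ := by
    intro h
    have h' : (((1 : rootsOfUnity 2 ℤ_[2]) : ℤ_[2]ˣ) : ℤ_[2]) = ((ζ : ℤ_[2]ˣ) : ℤ_[2]) := by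
      rw [h]
    rw [hζ] at h'
    simp only [OneMemClass.coe_one, Units.val_one, Units.val_neg] at h'
    have h2 : (2 : ℤ_[2]) = 0 := by linear_combination h'
    exact two_ne_zero h2
  haveI : Fintype (rootsOfUnity 2 ℤ_[2]) := Fintype.ofFinite _
  have huniv : (Finset.univ : Finset (rootsOfUnity 2 ℤ_[2])) = {1, ζ} := by
    ext ξ
    simp only [Finset.mem_univ, Finset.mem_insert, Finset.mem_singleton, true_iff]
    rcases coe_rootsOfUnity_two_eq_or' ξ with h | h
    · left
      exact Subtype.ext (Units.ext (by simpa using h))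
    · right
      exact Subtype.ext (Units.ext (by rw [hζ]; simpa using h))
  rw [finsum_eq_sum_of_fintype, huniv, Finset.sum_pair hne]
  simp only [OneMemClass.coe_one, Units.val_one, hζ, Units.val_neg]

/-- **`[(−x)/2ʲ]⁺_f = [x/2ʲ]⁺_f` for `x ∈ ℤ/2ʲ`** (representatives in `[0, 2ʲ)`): `(−x).val = 2ʲ − x.val`,
periodicity `[r + 1]⁺ = [r]⁺` (`ratPlusSymbol_add_intCast_eq`) and evenness `[−r]⁺ = [r]⁺`
(`ratPlusSymbol_neg`) — the step of `msdMeasure_neg`, isolated. [cite: MazurTateTeitelbaum1986Invent, §I.8 ([−r]⁺ = [r]⁺)] -/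
theorem ratPlusSymbol_neg_val_div (f : CuspForm (Gamma0 N) 2) (j : ℕ) (x : ZMod (2 ^ j)) :
    ratPlusSymbol f ((((-x).val : ℕ) : ℚ) / ((2 : ℕ) : ℚ) ^ j) =
      ratPlusSymbol f (((x.val : ℕ) : ℚ) / ((2 : ℕ) : ℚ) ^ j) := by
  by_cases hx : x = 0
  · subst hx; rw [neg_zero]
  haveI : NeZero (2 ^ j) := ⟨pow_ne_zero _ two_ne_zero⟩
  have hval : (-x).val = 2 ^ j - x.val := by rw [ZMod.neg_val, if_neg hx]
  have hlt : x.val ≤ 2 ^ j := (ZMod.val_lt x).le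
  have hcast : (((-x).val : ℕ) : ℚ) = (2 : ℚ) ^ j - (x.val : ℚ) := by
    rw [hval, Nat.cast_sub hlt]; push_cast; ring
  have e : (((-x).val : ℕ) : ℚ) / ((2 : ℕ) : ℚ) ^ j =
      -((((x.val : ℕ) : ℚ)) / ((2 : ℕ) : ℚ) ^ j) + ((1 : ℤ) : ℚ) := by
    rw [hcast]; push_cast; field_simp; ring
  rw [e, ratPlusSymbol_add_intCast_eq, ratPlusSymbol_neg]

omit [NeZero N] in
/-- The denominator of `v / 2ʲ` divides `2ʲ` (private arithmetic helper). [folklore] -/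
private theorem den_natCast_div_two_pow_dvd (v j : ℕ) :
    (((v : ℕ) : ℚ) / ((2 : ℕ) : ℚ) ^ j).den ∣ 2 ^ j := by
  have h := Rat.den_dvd (v : ℤ) ((2 : ℤ) ^ j)
  rw [Rat.divInt_eq_div] at h
  push_cast at h
  exact_mod_cast h

/-- **`4 ∤ N` for the level of the newform of a curve SPLIT multiplicative at `2`**: `a₂(f) = a₂(E) = 1`
(`IsNewformOf.cuspCoeff_eq_one_and_sq_of_split`), and `p² ∣ N ⇒ a_p(f) = 0` (Atkin–Lehner 1970 Thm. 3,
`IsNewformOf.not_sq_dvd_level_of_lFunction_ne_zero`). [cite: AtkinLehner1970, Thm. 3] -/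
theorem not_four_dvd_level_of_split (hsp : W.HasSplitMultiplicativeReductionAtPrime 2)
    (hf : IsNewformOf W f) : ¬ 4 ∣ N := by
  have ha₂ : cuspCoeff f 2 = 1 := (hf.cuspCoeff_eq_one_and_sq_of_split hsp).1
  have hL2 : W.LFunction 2 ≠ 0 := by
    intro h0
    rw [hf.2 2, h0] at ha₂
    norm_num at ha₂
  have h := hf.not_sq_dvd_level_of_lFunction_ne_zero Nat.prime_two hL2
  norm_num at h
  exact h

/-- **`‖[x/2ʲ]⁺_f‖₂ ≤ 2` for the newform of a curve SPLIT multiplicative at `2`** (`x ∈ ℤ/2ʲ`,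
`x ≠ 0`): `[x/2ʲ]⁺ ∈ [1/2]⁺ + ½ℤ = ½ℤ` (`exists_ratPlusSymbol_sub_half_eq_div_two`,
`ratPlusSymbol_half_eq_zero_of_cuspCoeff_two_eq_one`), and `‖k/2‖₂ ≤ 2`. [cite: MazurTateTeitelbaum1986Invent, §I.8 and §I.10] -/
theorem norm_ratPlusSymbol_val_div_le_two_of_split (hsp : W.HasSplitMultiplicativeReductionAtPrime 2)
    (hf : IsNewformOf W f) {j : ℕ} {x : ZMod (2 ^ j)} (hx : x ≠ 0) :
    ‖((ratPlusSymbol f (((x.val : ℕ) : ℚ) / ((2 : ℕ) : ℚ) ^ j) : ℚ) : ℚ_[2])‖ ≤ 2 := by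
  have hQ : coeffField f = ⊥ := hf.coeffField_eq_bot
  have hrat : ∀ r : ℚ, (ratPlusSymbol f r : ℝ) = normalizedPlusSymbol f r :=
    ratCast_ratPlusSymbol_holds hf.1 hQ
  have hreal : ∀ n, (cuspCoeff f n).im = 0 := cuspCoeff_im_eq_zero_of_coeffField_eq_bot hQ
  have ha₂ : cuspCoeff f 2 = 1 := (hf.cuspCoeff_eq_one_and_sq_of_split hsp).1
  have h2N : 2 ∣ N := hf.dvd_level_of_split hsp
  have h4 : ¬ 4 ∣ N := not_four_dvd_level_of_split hsp hf
  haveI : NeZero (2 ^ j) := ⟨pow_ne_zero _ two_ne_zero⟩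
  set r : ℚ := ((x.val : ℕ) : ℚ) / ((2 : ℕ) : ℚ) ^ j with hr_def
  have hr : r.den ∣ 2 ^ j := den_natCast_div_two_pow_dvd x.val j
  have hr1 : r.den ≠ 1 := by
    intro h1
    have hv0 : x.val ≠ 0 := fun h0 ↦ hx ((ZMod.val_eq_zero x).mp h0)
    have hvlt : x.val < 2 ^ j := ZMod.val_lt x
    have hr0 : 0 < r := by
      rw [hr_def]; push_cast; positivity
    have hrlt : r < 1 := by
      rw [hr_def, div_lt_one (by positivity)]
      exact_mod_cast hvlt
    have hrint : (r.num : ℚ) = r := by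
      conv_rhs => rw [← Rat.num_div_den r]
      rw [h1]; simp
    have h0 : (0 : ℚ) < r.num := by rw [hrint]; exact hr0
    have h1' : (r.num : ℚ) < 1 := by rw [hrint]; exact hrlt
    have h0z : 0 < r.num := by exact_mod_cast h0
    have h1z : r.num < 1 := by exact_mod_cast h1'
    omega
  obtain ⟨k, hk⟩ := exists_ratPlusSymbol_sub_half_eq_div_two f hrat hreal h2N h4 hr hr1
  rw [ratPlusSymbol_half_eq_zero_of_cuspCoeff_two_eq_one f hrat hf.1 h2N ha₂, sub_zero] at hk
  rw [hk]
  have h2 : ‖(2 : ℚ_[2])‖ = (2 : ℝ)⁻¹ := by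
    have h := Padic.norm_p (p := 2)
    simpa using h
  have hkn : ‖((k : ℚ) : ℚ_[2])‖ ≤ 1 := by
    have h := Padic.norm_int_le_one (p := 2) k
    simpa using h
  push_cast
  rw [norm_div, h2]
  calc ‖(k : ℚ_[2])‖ / (2 : ℝ)⁻¹ = 2 * ‖(k : ℚ_[2])‖ := by ring
    _ ≤ 2 * 1 := by gcongr; simpa using hkn
    _ = 2 := by ring

/-- **INT2-AUTO-sp: `‖[Tᵏ] L₂(E, T)‖₂ ≤ 1` at a SPLIT multiplicative `2`, unconditionally.** For
`E = W/ℚ` split multiplicative at `2`, `f` its newform (any level) and ANY `L` with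
`IsSplitMultPAdicLFunctionOf f 2 L`: the Riemann sums `∑_{u = ±1} ∑_{s mod 2ⁿ} [u·5ˢ/2ⁿ⁺²]⁺·C(s,k)`
converge to `[Tᵏ]L` (`IsSplitMultPAdicLFunctionOf.tendsto_riemannSum_coeff`, MTT §I.13); by the
`Δ = {±1}` doubling (`ratPlusSymbol_neg_val_div`) each is `2 ×` a sum of terms of norm `≤ 2`
(`norm_ratPlusSymbol_val_div_le_two_of_split`; the binomials are integers), so of norm `≤ 1`, and the
unit ball is closed. No hypothesis on `E[2]`, the `2`-adic image or the Manin constant.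
[cite: MazurTateTeitelbaum1986Invent, §I.10 and §I.12–I.13 (p = 2: Δ = {±1}, γ = 5)] -/
theorem norm_coeff_le_one_of_isSplitMultPAdicLFunctionOf_two [W.IsElliptic]
    (hsp : W.HasSplitMultiplicativeReductionAtPrime 2) (hf : IsNewformOf W f)
    {L : PowerSeries ℚ_[2]} (hL : IsSplitMultPAdicLFunctionOf f 2 L) (k : ℕ) :
    ‖PowerSeries.coeff k L‖ ≤ 1 := by
  classical
  have hlim := hL.tendsto_riemannSum_coeff hsp hf k
  refine le_of_tendsto hlim.norm (Eventually.of_forall fun n ↦ ?_)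
  -- the summand as a function of the Teichmüller representative
  set j : ℕ := n + cyclotomicExponent 2 with hj
  have hj0 : j ≠ 0 := by
    rw [hj, cyclotomicExponent_two]; omega
  set G : ℤ_[2] → ℚ_[2] := fun u ↦ ∑ s : ZMod (2 ^ n),
    (ratPlusSymbol f
        ((((PadicInt.toZModPow j u) * (cyclotomicGenerator 2 : ZMod (2 ^ j)) ^ s.val).val : ℚ) /
          ((2 : ℕ) : ℚ) ^ j) : ℚ_[2]) * ((s.val.choose k : ℕ) : ℚ_[2]) with hG
  have hRS : (∑ᶠ u : rootsOfUnity (torsionOrder 2) ℤ_[2], ∑ s : ZMod (2 ^ n),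
      (ratPlusSymbol f
        ((((PadicInt.toZModPow (n + cyclotomicExponent 2) ((u : ℤ_[2]ˣ) : ℤ_[2])) *
            (cyclotomicGenerator 2 : ZMod (2 ^ (n + cyclotomicExponent 2))) ^ s.val).val : ℚ) /
          ((2 : ℕ) : ℚ) ^ (n + cyclotomicExponent 2)) : ℚ_[2]) * ((s.val.choose k : ℕ) : ℚ_[2])) =
      ∑ᶠ u : rootsOfUnity (torsionOrder 2) ℤ_[2], G ((u : ℤ_[2]ˣ) : ℤ_[2]) := rfl
  have hGneg : G (-1) = G 1 := by
    simp only [hG, map_neg, map_one, neg_one_mul, one_mul]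
    refine Finset.sum_congr rfl fun s _ ↦ ?_
    rw [ratPlusSymbol_neg_val_div]
  have hγ : IsUnit (cyclotomicGenerator 2 : ZMod (2 ^ j)) := isUnit_cyclotomicGenerator_cast (p := 2) j
  have hG1 : ‖G 1‖ ≤ 2 := by
    simp only [hG, map_one, one_mul]
    refine IsUltrametricDist.norm_sum_le_of_forall_le_of_nonneg zero_le_two fun s _ ↦ ?_
    have hx : (cyclotomicGenerator 2 : ZMod (2 ^ j)) ^ s.val ≠ 0 := by
      haveI : Nontrivial (ZMod (2 ^ j)) := by
        haveI : Fact (1 < 2 ^ j) := ⟨Nat.one_lt_two_pow hj0⟩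
        infer_instance
      exact (hγ.pow _).ne_zero
    have hc : ‖((s.val.choose k : ℕ) : ℚ_[2])‖ ≤ 1 := by
      have h := Padic.norm_int_le_one (p := 2) ((s.val.choose k : ℕ) : ℤ)
      rwa [Int.cast_natCast] at h
    rw [norm_mul]
    calc _ ≤ 2 * 1 := mul_le_mul (norm_ratPlusSymbol_val_div_le_two_of_split hsp hf hx) hc
          (norm_nonneg _) zero_le_two
      _ = 2 := mul_one _
  have h2 : ‖(2 : ℚ_[2])‖ = (2 : ℝ)⁻¹ := by
    have h := Padic.norm_p (p := 2)
    simpa using h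
  rw [hRS, torsionOrder_two, finsum_rootsOfUnity_two_eq, hGneg, ← two_mul, norm_mul, h2]
  calc (2 : ℝ)⁻¹ * ‖G 1‖ ≤ (2 : ℝ)⁻¹ * 2 := by gcongr
    _ = 1 := by norm_num

/-- **`L₂(E, T) ∈ Λ = ℤ₂⟦T⟧` for EVERY curve split multiplicative at `2`** (the lens-3 S5 / refuter
INT2-AUTO-sp shape `∃ L₀ : IwasawaAlgebra 2, ι L₀ = L` for the `L` of `IsSplitMultPAdicLFunctionOf f 2 L`):
coefficientwise criterion `exists_iwasawaToPowerSeries_eq_iff_norm_coeff_le_one`. In the residual cell's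
currency: on the split-`2` locus the `hint` binder of `missingUpperBoundAt_two_split_of_mu_eq_zero`
reduces to the period comparison `0 ≤ ord₂(Ω⁺_f/Ω_W)`. [cite: MazurTateTeitelbaum1986Invent, §I.12] -/
theorem exists_iwasawaToPowerSeries_eq_of_isSplitMultPAdicLFunctionOf_two [W.IsElliptic]
    (hsp : W.HasSplitMultiplicativeReductionAtPrime 2) (hf : IsNewformOf W f)
    {L : PowerSeries ℚ_[2]} (hL : IsSplitMultPAdicLFunctionOf f 2 L) :
    ∃ L₀ : IwasawaAlgebra 2, iwasawaToPowerSeries 2 L₀ = L :=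
  (exists_iwasawaToPowerSeries_eq_iff_norm_coeff_le_one _).mpr fun k ↦
    norm_coeff_le_one_of_isSplitMultPAdicLFunctionOf_two hsp hf hL k

end Split

end Literature.NumberTheory.EllipticCurves

end
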